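import Literature.MathematicalPhysics.QuantumLattice.HubbardTorusFlux
import Literature.MathematicalPhysics.QuantumLattice.PairCorrelations
import Mathlib.Combinatorics.SimpleGraph.Bipartite
import Mathlib.Analysis.SpecialFunctions.Trigonometric.Basic
import HarnessLib

/-!
# The Hubbard model on the diagonal-glide Klein bottle with a Peierls flux through the glide cycle

Trunk T-QLATTICE, family `hubbard`; definition request `defn-hubbardKleinBottleFlux` of route
`FluxSpectroscopy` (cruxes `FluxWindow`, `KleinSelection`, `OverlapNondegeneracy` of
`Summits/HubbardSuperconductivity/…/Theses/FluxSpectroscopy.lean`, where the objects below are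
inlined as `let EK := …`).

## The lattice

The **diagonal-glide Klein bottle** of side `L` is the quotient graph `K_L := ℤ² / Γ`,
`Γ = ⟨a, b⟩` with the glide `a (x, y) = (y + L, x + L)` (mirror in the diagonal `x = y` composed
with the diagonal translation; it swaps horizontal and vertical bonds) and the translation
`b (x, y) = (x + L, y - L)`; it has `2L²` vertices. In the **glide coordinates**
`u = x + y`, `w = -y (mod L)` one has `b (u, w) = (u, w + L) ≡ (u, w)` and
`a (u, w) = (u + 2L, -u - w)`, so `{0, …, 2L-1} × ℤ/L` is a fundamental domain and the
nearest-neighbour bonds of `ℤ²` become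

* the *bulk steps* `(u, w) ∼ (u + 1, w)` (an `x`-step) and `(u, w) ∼ (u + 1, w - 1)` (a `y`-step)
  for `u + 1 < 2L` (`kleinBottleStep`), and
* across the *glide seam* `u = 2L - 1 | u = 0`: `(2L - 1, w) ∼ (0, -w)` (`x`-step) and
  `(2L - 1, w) ∼ (0, 1 - w)` (`y`-step) (`kleinBottleSeam`), because `(2L, w') = a (0, -w')`.

`kleinBottleGraph L` is `SimpleGraph.fromRel` of exactly this relation on
`KleinBottleSite L = Lex (Fin (2 * L) × Fin L)` (lexicographic order: the Jordan–Wigner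
construction of `HubbardWave0` needs a `LinearOrder`); it is literally (`rfl`,
`kleinBottleGraph_eq_fromRel`) the graph written inline in the route file. The parity of `u` is a
proper `2`-colouring for every `L ≥ 1` (`kleinBottleColoring`, `isBipartite_kleinBottleGraph`);
for `L ≥ 2` the graph is `4`-regular and is the quotient `ℤ²/Γ` (the route checked this by
enumeration for `L ≤ 7`; the covering statement is not formalised in this file). **Degenerate
side `L = 1`:** `K_1` has two vertices and the bulk step `(0,0) ∼ (1,0)` coincides with the seam
bond, so the simple graph is a single edge (a multigraph would be needed); all definitions still
make sense and nothing below assumes `L ≥ 2`.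

## The flux Hamiltonian

Threading an Aharonov–Bohm flux `θ` (in units `ħ/e`) through the glide cycle `a` means
multiplying the hopping amplitude of an electron crossing the seam in the `+u` direction by the
Peierls phase `e^{iθ}` (and by `e^{-iθ}` in the `-u` direction), all other bonds unchanged: this is
the Peierls substitution of Essler–Frahm–Göhmann–Klümper–Korepin (2005) §1.3, eqs. (1.25)–(1.27),
in the gauge where the whole line integral of the vector potential sits on the seam bonds
(Byers–Yang 1961: the flux through a hole of a multiply connected sample enters only through such
a twisted boundary condition). With the seam hopping operator
`J = kleinBottleSeamHop L = Σ_{seam (p, q)} Σ_σ c†_{qσ} c_{pσ}` (`p` on `u = 2L-1`, `q` on `u = 0`)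
the Hamiltonian is

  `hubbardKleinBottleFlux L U θ = hamiltonian (kleinBottleGraph L) 1 U + (1 - e^{iθ}) J + (1 - e^{-iθ}) Jᴴ`

(`hamiltonian G 1 U` contains `-(J + Jᴴ)`, so the seam hoppings become `-e^{iθ} J - e^{-iθ} Jᴴ`;
hopping `t = 1` as in the summit statement), and the sector energy of the route is

  `kleinBottleFluxEnergy L U δ θ = minEnergyOn (szSector (2⌊(1-δ)L²⌋) 0)`

(`2⌊(1-δ)L²⌋` electrons on `2L²` sites, i.e. hole doping `→ δ`, `S^z = 0`). The holonomy is
`e^{iθ}` around `a` and trivial around `b`. Why the route wants it: a pair condensate odd under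
`x ↔ y` (`d_{x²-y²}`, `B₁g`) changes sign under the glide (`dWaveFormFactor_swap`), so on `K_L` it
is a section of the non-trivial `ℤ₂`-bundle and is unfrustrated exactly at half a superconducting
flux quantum `θ = π/2` — the lattice form of the `π`-ring / tricrystal half-flux-quantum effect
(Geshkenbein–Larkin–Barone 1987; Sigrist–Rice 1992; Tsuei–Kirtley 2000; Xiang–Wu 2022 §6.2,
eq. (6.33)), structurally Kronfeld–Wiese's `C`-periodic boundary condition with charge conjugation
replaced by the glide.

## API (all proved)

* graph: `kleinBottleGraph_adj_iff`, decidability instances, `card_kleinBottleSite` (`2L²` sites),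
  `kleinBottleGraph_adj_of_seam`, `kleinBottleColoring` / `isBipartite_kleinBottleGraph`
  (`u`-parity), `kleinBottleGraph_eq_fromRel` (the route's literal relation, `rfl`);
* Hamiltonian: `hubbardKleinBottleFlux_zero` (`θ = 0` is the plain Hubbard model on `K_L`),
  `hubbardKleinBottleFlux_periodic` (period `2π` = one flux quantum `h/e`),
  `isHermitian_hubbardKleinBottleFlux`, `hubbardKleinBottleFlux_map_conj` (complex conjugation in
  the occupation basis is `θ ↦ -θ`), `hubbardKleinBottleFlux_eq_inline` (equality with the
  `Σ_{b : Bool}` form inlined in the route file);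
* spectra: `kleinBottleFluxEnergy_neg` (`E(-θ) = E(θ)`, from `minEnergyOn_map_conj` and
  `star_mem_szSector` of `HubbardTorusFlux.lean`), `kleinBottleFluxEnergy_periodic`;
* conservation laws (section `Conservation`, appended): `preservesSectors_hubbardKleinBottleFlux`
  (`N↑`, `N↓` conserved), `hubbardKleinBottleFlux_commute_totalNumber`, `_commute_spinZ`,
  `_commute_spinPlus`, `_commute_spinMinus`, `_commute_spinVecF` (full spin-rotation invariance:
  the flux couples to the charge only);
* `dWaveFormFactor_swap`: the glide acts on bond directions by `x ↔ y`, under which the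
  `d_{x²-y²}` form factor is odd.

## Mathlib / tree search

Mathlib has `SimpleGraph.fromRel` (with its `DecidableRel` instance), `SimpleGraph.Coloring`,
`SimpleGraph.IsBipartite`, `Matrix.map`, `Complex.exp_conj`, `Complex.exp_two_pi_mul_I`; no Klein
bottle graphs, no Peierls phases (`lean search 'KleinBottle|Peierls'`: nothing). Reused from the
tree: `hamiltonian`, `creation`, `annihilation`, `szSector`, `Matrix.minEnergyOn`,
`hamiltonian_isHermitian_and_commute_holds`, `dWaveFormFactor`, and the conjugation machinery of
the sibling torus file `HubbardTorusFlux.lean` (`hubbardTorusFlux`, `fluxEnergy` = the route's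
`E^T`): `map_conj_sum`, `map_conj_smul`, `map_conj_ite`, `creation_map_conj`,
`annihilation_map_conj`, `hamiltonian_map_conj`, `star_mem_szSector`, `minEnergyOn_map_conj`.

## References

* F. H. L. Essler, H. Frahm, F. Göhmann, A. Klümper, V. E. Korepin, *The One-Dimensional Hubbard
  Model*, CUP (2005), §1.3, eqs. (1.25)–(1.27) (Peierls phases; Hubbard ring threaded by a flux).
  [EsslerEtAl2005]
* N. Byers, C. N. Yang, PRL 7 (1961) 46 (flux through a multiply connected superconductor as a
  boundary-condition twist; period `hc/e`). [ByersYang1961]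
* T. Xiang, C. Wu, *D-wave Superconductivity*, CUP (2022), §6.2, eq. (6.33) and §6.3 (half flux
  quantum in a loop with an odd number of `π`-junctions; tricrystal experiment). [XiangWu2022]
* V. B. Geshkenbein, A. I. Larkin, A. Barone, PRB 36 (1987) 235; M. Sigrist, T. M. Rice, JPSJ 61
  (1992) 4283; C. C. Tsuei, J. R. Kirtley, RMP 72 (2000) 969. [GeshkenbeinLarkinBarone1987]
  [SigristRice1992] [TsueiKirtley2000]
* A. S. Kronfeld, U.-J. Wiese, Nucl. Phys. B 357 (1991) 521 (`C`-periodic boundary conditions).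
  [KronfeldWiese1991]
-/

noncomputable section

namespace Literature.MathematicalPhysics.QuantumLattice

open Matrix Finset Literature.Probability.LatticeModels
open scoped ComplexOrder ComplexConjugate

/-! ### The diagonal-glide Klein bottle in glide coordinates -/

/-- The vertex set of the diagonal-glide Klein bottle `K_L` in glide coordinates
`(u, w) ∈ Fin (2L) × Fin L` (`u = x + y`, `w = -y mod L`), with the lexicographic linear order
needed by the Jordan–Wigner construction. [folklore] -/
abbrev KleinBottleSite (L : ℕ) : Type := Lex (Fin (2 * L) × Fin L)

section Graph

variable (L : ℕ) [NeZero L]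

/-- The bulk nearest-neighbour steps of `K_L` in glide coordinates, oriented in the `+u`
direction: `(u, w) → (u + 1, w)` (an `x`-step of `ℤ²`) and `(u, w) → (u + 1, w - 1)` (a `y`-step),
for `u + 1 < 2L`. [folklore] -/
def kleinBottleStep (p q : KleinBottleSite L) : Prop :=
  (ofLex p).1.val + 1 = (ofLex q).1.val ∧ ((ofLex q).2 = (ofLex p).2 ∨ (ofLex q).2 = (ofLex p).2 - 1)

/-- The seam bonds of `K_L`, oriented in the `+u` direction across the glide seam: from
`p = (2L - 1, w)` to `q = (0, -w)` (`x`-step) or `q = (0, 1 - w)` (`y`-step); these are the images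
of the `ℤ²`-bonds `(2L - 1, w) ∼ (2L, w), (2L, w - 1)` under `(2L, w') = a (0, -w')`,
`a (x, y) = (y + L, x + L)` the glide. [folklore] -/
def kleinBottleSeam (p q : KleinBottleSite L) : Prop :=
  (ofLex p).1.val + 1 = 2 * L ∧ (ofLex q).1.val = 0 ∧
    ((ofLex q).2 = -(ofLex p).2 ∨ (ofLex q).2 = -(ofLex p).2 + 1)

/-- The bulk-step relation is decidable (structurally, as the route's inline term decides it). [folklore] -/
instance instDecidableRelKleinBottleStep : DecidableRel (kleinBottleStep L) := fun p q =>
  inferInstanceAs (Decidable ((ofLex p).1.val + 1 = (ofLex q).1.val ∧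
    ((ofLex q).2 = (ofLex p).2 ∨ (ofLex q).2 = (ofLex p).2 - 1)))

/-- The seam relation is decidable (structurally, as the route's inline term decides it). [folklore] -/
instance instDecidableRelKleinBottleSeam : DecidableRel (kleinBottleSeam L) := fun p q =>
  inferInstanceAs (Decidable ((ofLex p).1.val + 1 = 2 * L ∧ (ofLex q).1.val = 0 ∧
    ((ofLex q).2 = -(ofLex p).2 ∨ (ofLex q).2 = -(ofLex p).2 + 1)))

/-- The nearest-neighbour graph of the diagonal-glide Klein bottle
`K_L = ℤ² / ⟨(x, y) ↦ (y + L, x + L), (x, y) ↦ (x + L, y - L)⟩` in glide coordinates: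
`SimpleGraph.fromRel` (symmetrised, made irreflexive) of "bulk step or seam bond". `2L²`
vertices; `4`-regular for `L ≥ 2`; bipartite by `u`-parity (`isBipartite_kleinBottleGraph`). For
`L = 1` the bulk and seam bonds coincide (documented degenerate side). [folklore] -/
def kleinBottleGraph : SimpleGraph (KleinBottleSite L) :=
  SimpleGraph.fromRel fun p q => kleinBottleStep L p q ∨ kleinBottleSeam L p q

/-- Adjacency in `kleinBottleGraph` is decidable. [folklore] -/
instance instDecidableRelKleinBottleGraphAdj : DecidableRel (kleinBottleGraph L).Adj :=
  inferInstanceAs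
    (DecidableRel (SimpleGraph.fromRel fun p q => kleinBottleStep L p q ∨ kleinBottleSeam L p q).Adj)

/-- `kleinBottleGraph L` is, by `rfl`, `SimpleGraph.fromRel` of the literal relation inlined as
`let EK := …` in the route file `Theses/FluxSpectroscopy.lean`. [folklore] -/
theorem kleinBottleGraph_eq_fromRel :
    kleinBottleGraph L = SimpleGraph.fromRel fun p q : Lex (Fin (2 * L) × Fin L) =>
      ((ofLex p).1.val + 1 = (ofLex q).1.val ∧
          ((ofLex q).2 = (ofLex p).2 ∨ (ofLex q).2 = (ofLex p).2 - 1)) ∨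
        ((ofLex p).1.val + 1 = 2 * L ∧ (ofLex q).1.val = 0 ∧
          ((ofLex q).2 = -(ofLex p).2 ∨ (ofLex q).2 = -(ofLex p).2 + 1)) :=
  rfl

variable {L}

/-- Adjacency in `K_L`, unfolded: distinct vertices related by a bulk step or a seam bond in
either direction. [folklore] -/
theorem kleinBottleGraph_adj_iff (p q : KleinBottleSite L) :
    (kleinBottleGraph L).Adj p q ↔ p ≠ q ∧
      ((kleinBottleStep L p q ∨ kleinBottleSeam L p q) ∨ (kleinBottleStep L q p ∨ kleinBottleSeam L q p)) :=
  Iff.rfl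

/-- A seam bond is an edge of `K_L` (its endpoints have `u = 2L - 1 ≠ 0`). [folklore] -/
theorem kleinBottleGraph_adj_of_seam {p q : KleinBottleSite L} (h : kleinBottleSeam L p q) :
    (kleinBottleGraph L).Adj p q := by
  refine ⟨?_, Or.inl (Or.inr h)⟩
  rintro rfl
  obtain ⟨h1, h2, -⟩ := h
  have hL : 0 < L := Nat.pos_of_ne_zero (NeZero.ne L)
  omega

/-- A bulk step is an edge of `K_L`. [folklore] -/
theorem kleinBottleGraph_adj_of_step {p q : KleinBottleSite L} (h : kleinBottleStep L p q) :
    (kleinBottleGraph L).Adj p q := by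
  refine ⟨?_, Or.inl (Or.inl h)⟩
  rintro rfl
  obtain ⟨h1, -⟩ := h
  omega

variable (L)

omit [NeZero L] in
/-- `K_L` has `2L²` sites. [folklore] -/
theorem card_kleinBottleSite : Fintype.card (KleinBottleSite L) = 2 * L ^ 2 := by
  change Fintype.card (Lex (Fin (2 * L) × Fin L)) = _
  rw [Fintype.card_lex, Fintype.card_prod, Fintype.card_fin, Fintype.card_fin]
  ring

variable {L}

/-- Along every edge of `K_L` the parity of the glide coordinate `u` flips: bulk steps change `u`
by `±1`, seam bonds join `u = 2L - 1` (odd) to `u = 0`. [folklore] -/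
theorem kleinBottleGraph_val_mod_two_ne {p q : KleinBottleSite L} (h : (kleinBottleGraph L).Adj p q) :
    (ofLex p).1.val % 2 ≠ (ofLex q).1.val % 2 := by
  obtain ⟨-, (⟨h1, -⟩ | ⟨h1, h2, -⟩) | (⟨h1, -⟩ | ⟨h1, h2, -⟩)⟩ := h <;> omega

variable (L)

/-- The `u`-parity `2`-colouring of `K_L` (the bipartition of `ℤ²` by the parity of `x + y`
descends to the Klein bottle, the glide and `b` both preserving it). [folklore] -/
def kleinBottleColoring : (kleinBottleGraph L).Coloring (Fin 2) :=
  SimpleGraph.Coloring.mk (fun p => ⟨(ofLex p).1.val % 2, Nat.mod_lt _ Nat.two_pos⟩)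
    fun h hc => kleinBottleGraph_val_mod_two_ne h (congrArg Fin.val hc)

/-- `K_L` is bipartite (for every `L ≥ 1`). [folklore] -/
theorem isBipartite_kleinBottleGraph : (kleinBottleGraph L).IsBipartite :=
  ⟨kleinBottleColoring L⟩

end Graph

/-! ### The glide flips the sign of the `d_{x²-y²}` form factor -/

/-- The glide `a (x, y) = (y + L, x + L)` acts on bond directions `e ∈ ℤ²` by the swap
`(e₀, e₁) ↦ (e₁, e₀)`, under which the `d_{x²-y²}` form factor is odd:
`g_d (e₁, e₀) = -g_d (e₀, e₁)`. Hence a `d_{x²-y²}` bond field on `ℤ²` descends to `K_L` only as a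
section of the non-trivial `ℤ₂`-bundle — the source of the half-flux-quantum preference
(Xiang–Wu 2022 §6.2, eq. (6.33): an odd number of sign changes around a loop shifts the flux
quantisation by `Φ₀/2`). [cite: XiangWu2022, §6.2 eq. (6.33)] -/
theorem dWaveFormFactor_swap (e : Site 2) : dWaveFormFactor ![e 1, e 0] = -dWaveFormFactor e := by
  have key : ∀ (i : Fin 2) (c : ℤ), (![e 1, e 0] = Pi.single i c ↔ e = Pi.single (1 - i) c) := by
    intro i c
    fin_cases i <;>
    · constructor
      · intro h
        funext j
        fin_cases j
        · simpa using congrFun h 1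
        · simpa using congrFun h 0
      · intro h
        rw [h]
        funext j
        fin_cases j <;> simp
  have hneg : ∀ i : Fin 2, (-Pi.single i 1 : Site 2) = Pi.single i (-1) := fun i => by
    rw [← Pi.single_neg]
  simp only [dWaveFormFactor, hneg, key]
  have h01 : (Pi.single 0 1 : Site 2) ≠ Pi.single 1 1 := fun h => by simpa using congrFun h 0
  have h01' : (Pi.single 0 1 : Site 2) ≠ Pi.single 1 (-1) := fun h => by simpa using congrFun h 0
  have h0'1 : (Pi.single 0 (-1) : Site 2) ≠ Pi.single 1 1 := fun h => by simpa using congrFun h 0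
  have h0'1' : (Pi.single 0 (-1) : Site 2) ≠ Pi.single 1 (-1) := fun h => by simpa using congrFun h 0
  by_cases ha : e = Pi.single 1 1 ∨ e = Pi.single 1 (-1)
  · have hb : ¬ (e = Pi.single 0 1 ∨ e = Pi.single 0 (-1)) := by
      rintro (h | h) <;> rcases ha with h' | h' <;> simp_all
    simp [ha, hb]
  · by_cases hb : e = Pi.single 0 1 ∨ e = Pi.single 0 (-1)
    · simp [ha, hb]
    · simp [ha, hb]

/-! ### The seam hopping operator and the flux Hamiltonian -/

section Flux

variable (L : ℕ) [NeZero L]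

/-- The seam hopping operator `J = Σ_{seam (p, q)} Σ_σ c†_{qσ} c_{pσ}`: it moves one electron
across the glide seam in the `+u` direction (from `u = 2L - 1` to `u = 0 ≡ 2L`); `Jᴴ` moves it
back. The Peierls phase of a flux `θ` through the glide cycle multiplies `J` by `e^{iθ}`
(Essler et al. 2005 §1.3, eq. (1.26), all phases gauged onto one bond).
[cite: EsslerEtAl2005, §1.3 eq. (1.26)] -/
def kleinBottleSeamHop :
    Matrix (Finset (Orb (KleinBottleSite L))) (Finset (Orb (KleinBottleSite L))) ℂ :=
  ∑ p : KleinBottleSite L, ∑ q : KleinBottleSite L, ∑ σ : Fin 2,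
    if kleinBottleSeam L p q then creation (orb q σ) * annihilation (orb p σ) else 0

/-- **The Hubbard model on the diagonal-glide Klein bottle `K_L` threaded by the flux `θ`**
(hopping `t = 1`, on-site repulsion `U`): the Hubbard Hamiltonian `hamiltonian (kleinBottleGraph L) 1 U`
with the seam hoppings multiplied by the Peierls phase `e^{iθ}` for an electron crossing the seam
in the `+u` direction and `e^{-iθ}` in the `-u` direction, i.e.
`H(θ) = H(0) + (1 - e^{iθ}) J + (1 - e^{-iθ}) Jᴴ` with `J = kleinBottleSeamHop L` (since `H(0)`
contains `-(J + Jᴴ)`); holonomy `e^{iθ}` around the glide cycle `a`, trivial around `b`.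
Peierls substitution: Essler et al. (2005) §1.3, eqs. (1.25)–(1.27); flux as a boundary twist:
Byers–Yang (1961). [cite: EsslerEtAl2005, §1.3 eqs. (1.25)–(1.27)] -/
def hubbardKleinBottleFlux (U θ : ℝ) :
    Matrix (Finset (Orb (KleinBottleSite L))) (Finset (Orb (KleinBottleSite L))) ℂ :=
  hamiltonian (kleinBottleGraph L) 1 U +
    ((1 - Complex.exp (Complex.I * θ)) • kleinBottleSeamHop L +
      (1 - Complex.exp (-(Complex.I * θ))) • (kleinBottleSeamHop L)ᴴ)

/-- The sector ground-state energy `E^K_L(U, δ; θ)` of the route `FluxSpectroscopy`: the lowest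
energy (`Matrix.minEnergyOn`) of `hubbardKleinBottleFlux L U θ` in the joint sector of
`2⌊(1 - δ) L²⌋` electrons (density `1 - δ` on the `2L²` sites, hole doping `→ δ`) and `S^z = 0`.
Junk value `0` if the sector is `⊥` (e.g. `δ < 0` with `(1 - δ) L² ≥ 2L² + 1`).
The flux dependence of such sector minima is the Byers–Yang diagnostic of pairing (period `h/2e`
versus `h/e`). [cite: ByersYang1961] -/
def kleinBottleFluxEnergy (U δ θ : ℝ) : ℝ :=
  (hubbardKleinBottleFlux L U θ).minEnergyOn (szSector (2 * ⌊(1 - δ) * (L : ℝ) ^ 2⌋₊) 0)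

/-- The adjoint of the seam hopping operator moves an electron across the seam in the `-u`
direction: `Jᴴ = Σ_{seam (p, q)} Σ_σ c†_{pσ} c_{qσ}`. [folklore] -/
theorem kleinBottleSeamHop_conjTranspose :
    (kleinBottleSeamHop L)ᴴ = ∑ p : KleinBottleSite L, ∑ q : KleinBottleSite L, ∑ σ : Fin 2,
      if kleinBottleSeam L p q then creation (orb p σ) * annihilation (orb q σ) else 0 := by
  simp only [kleinBottleSeamHop, conjTranspose_sum]
  refine Finset.sum_congr rfl fun p _ => Finset.sum_congr rfl fun q _ =>
    Finset.sum_congr rfl fun σ _ => ?_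
  split_ifs
  · rw [conjTranspose_mul, creation_conjTranspose, annihilation_conjTranspose]
  · rw [conjTranspose_zero]

/-- At zero flux the model is the plain Hubbard model (`t = 1`) on the Klein bottle graph. [folklore] -/
@[simp] theorem hubbardKleinBottleFlux_zero (U : ℝ) :
    hubbardKleinBottleFlux L U 0 = hamiltonian (kleinBottleGraph L) 1 U := by
  simp [hubbardKleinBottleFlux]

/-- The flux Hamiltonian is `2π`-periodic in `θ` (one flux quantum `h/e` is a pure gauge;
Byers–Yang 1961). [cite: ByersYang1961] -/
theorem hubbardKleinBottleFlux_periodic (U : ℝ) :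
    Function.Periodic (hubbardKleinBottleFlux L U) (2 * Real.pi) := by
  intro θ
  have h1 : Complex.exp (Complex.I * ((θ + 2 * Real.pi : ℝ) : ℂ)) = Complex.exp (Complex.I * θ) := by
    rw [Complex.ofReal_add, mul_add, Complex.exp_add, Complex.ofReal_mul, Complex.ofReal_ofNat,
      show Complex.I * (2 * (Real.pi : ℂ)) = 2 * Real.pi * Complex.I by ring,
      Complex.exp_two_pi_mul_I, mul_one]
  have h2 : Complex.exp (-(Complex.I * ((θ + 2 * Real.pi : ℝ) : ℂ))) =
      Complex.exp (-(Complex.I * θ)) := by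
    rw [Complex.exp_neg, Complex.exp_neg, h1]
  rw [hubbardKleinBottleFlux, hubbardKleinBottleFlux, h1, h2]

/-- `star (1 - e^{iθ}) = 1 - e^{-iθ}` for real `θ`. [folklore] -/
theorem star_one_sub_exp_I_mul (θ : ℝ) :
    star (1 - Complex.exp (Complex.I * θ)) = 1 - Complex.exp (-(Complex.I * θ)) := by
  rw [star_sub, star_one, Complex.star_def, ← Complex.exp_conj, map_mul, Complex.conj_I,
    Complex.conj_ofReal, neg_mul]

/-- `star (1 - e^{-iθ}) = 1 - e^{iθ}` for real `θ`. [folklore] -/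
theorem star_one_sub_exp_neg_I_mul (θ : ℝ) :
    star (1 - Complex.exp (-(Complex.I * θ))) = 1 - Complex.exp (Complex.I * θ) := by
  rw [star_sub, star_one, Complex.star_def, ← Complex.exp_conj, map_neg, map_mul, Complex.conj_I,
    Complex.conj_ofReal, neg_mul, neg_neg]

/-- The flux Hamiltonian is Hermitian (the Peierls phases on `J` and `Jᴴ` are complex
conjugate). [folklore] -/
theorem isHermitian_hubbardKleinBottleFlux (U θ : ℝ) : (hubbardKleinBottleFlux L U θ).IsHermitian := by
  refine (hamiltonian_isHermitian_and_commute_holds (kleinBottleGraph L) 1 U).1.add ?_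
  change (_ : Matrix _ _ ℂ)ᴴ = _
  rw [conjTranspose_add, conjTranspose_smul, conjTranspose_smul, conjTranspose_conjTranspose,
    star_one_sub_exp_I_mul, star_one_sub_exp_neg_I_mul, add_comm]

/-- **Bridge to the route file.** `hubbardKleinBottleFlux L U θ` equals the operator inlined as
`let EK := …` in `Theses/FluxSpectroscopy.lean`: the Hubbard Hamiltonian of the literal
`fromRel` graph plus `Σ_{p q σ} Σ_{b : Bool} [seam p q] (1 - e^{± iθ}) c†c` with `b = true` the
`+u` hopping `c†_{qσ} c_{pσ}` (phase `e^{iθ}`) and `b = false` its adjoint. [folklore] -/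
theorem hubbardKleinBottleFlux_eq_inline (U θ : ℝ) :
    hubbardKleinBottleFlux L U θ =
      hamiltonian (SimpleGraph.fromRel fun p q : Lex (Fin (2 * L) × Fin L) =>
          ((ofLex p).1.val + 1 = (ofLex q).1.val ∧
              ((ofLex q).2 = (ofLex p).2 ∨ (ofLex q).2 = (ofLex p).2 - 1)) ∨
            ((ofLex p).1.val + 1 = 2 * L ∧ (ofLex q).1.val = 0 ∧
              ((ofLex q).2 = -(ofLex p).2 ∨ (ofLex q).2 = -(ofLex p).2 + 1))) 1 U +
        ∑ p : Lex (Fin (2 * L) × Fin L), ∑ q : Lex (Fin (2 * L) × Fin L), ∑ σ : Fin 2, ∑ b : Bool,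
          (if ((ofLex p).1.val + 1 = 2 * L ∧ (ofLex q).1.val = 0 ∧
                ((ofLex q).2 = -(ofLex p).2 ∨ (ofLex q).2 = -(ofLex p).2 + 1)) then
              (1 - Complex.exp ((if b then 1 else -1) * Complex.I * θ)) •
                (creation (orb (if b then q else p) σ) * annihilation (orb (if b then p else q) σ))
            else 0) := by
  unfold hubbardKleinBottleFlux
  congr 1
  rw [kleinBottleSeamHop_conjTranspose, kleinBottleSeamHop, Finset.smul_sum, Finset.smul_sum,
    ← Finset.sum_add_distrib]
  refine Finset.sum_congr rfl fun p _ => ?_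
  rw [Finset.smul_sum, Finset.smul_sum, ← Finset.sum_add_distrib]
  refine Finset.sum_congr rfl fun q _ => ?_
  rw [Finset.smul_sum, Finset.smul_sum, ← Finset.sum_add_distrib]
  refine Finset.sum_congr rfl fun σ _ => ?_
  rw [Fintype.sum_bool]
  simp only [Bool.false_eq_true, if_true, if_false, one_mul, neg_mul]
  by_cases h : kleinBottleSeam L p q
  · have h' : (ofLex p).1.val + 1 = 2 * L ∧ (ofLex q).1.val = 0 ∧
        ((ofLex q).2 = -(ofLex p).2 ∨ (ofLex q).2 = -(ofLex p).2 + 1) := h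
    rw [if_pos h, if_pos h, if_pos h', if_pos h']
  · have h' : ¬ ((ofLex p).1.val + 1 = 2 * L ∧ (ofLex q).1.val = 0 ∧
        ((ofLex q).2 = -(ofLex p).2 ∨ (ofLex q).2 = -(ofLex p).2 + 1)) := h
    rw [if_neg h, if_neg h, if_neg h', if_neg h', smul_zero, smul_zero]

end Flux

/-! ### Time reversal: complex conjugation sends `θ` to `-θ` -/

section Conj

variable (L : ℕ) [NeZero L]

/-- The seam hopping operator is real in the occupation basis (real Jordan–Wigner matrices). [folklore] -/
theorem kleinBottleSeamHop_map_conj :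
    (kleinBottleSeamHop L).map (starRingEnd ℂ) = kleinBottleSeamHop L := by
  unfold kleinBottleSeamHop
  simp only [map_conj_sum, map_conj_ite, Matrix.map_mul, creation_map_conj, annihilation_map_conj]

/-- **Time reversal**: entrywise complex conjugation in the (real) occupation basis reverses the
flux, `conj H(θ) = H(-θ)` (`H(0)` and `J` are real, `conj (1 - e^{iθ}) = 1 - e^{-iθ}`);
Byers–Yang (1961), `E(-Φ) = E(Φ)`. [cite: ByersYang1961] -/
theorem hubbardKleinBottleFlux_map_conj (U θ : ℝ) :
    (hubbardKleinBottleFlux L U θ).map (starRingEnd ℂ) = hubbardKleinBottleFlux L U (-θ) := by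
  rw [hubbardKleinBottleFlux, hubbardKleinBottleFlux, Matrix.map_add _ (map_add _),
    Matrix.map_add _ (map_add _), hamiltonian_map_conj, map_conj_smul, map_conj_smul,
    Matrix.conjTranspose_map (starRingEnd ℂ) (fun _ => rfl), kleinBottleSeamHop_map_conj,
    ← Complex.star_def, star_one_sub_exp_I_mul, star_one_sub_exp_neg_I_mul, Complex.ofReal_neg,
    mul_neg, neg_neg]

/-- **The sector energies are even in the flux** in every joint sector `(N, S^z = M)`:
conjugation preserves the sector (`star_mem_szSector`) and reverses the flux. [cite: ByersYang1961] -/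
theorem minEnergyOn_hubbardKleinBottleFlux_neg (U θ : ℝ) (N : ℕ) (M : ℝ) :
    (hubbardKleinBottleFlux L U (-θ)).minEnergyOn (szSector N M) =
      (hubbardKleinBottleFlux L U θ).minEnergyOn (szSector N M) := by
  rw [← hubbardKleinBottleFlux_map_conj]
  exact minEnergyOn_map_conj _ _ fun ψ h => star_mem_szSector h

/-- `E^K_L(U, δ; -θ) = E^K_L(U, δ; θ)`. [cite: ByersYang1961] -/
theorem kleinBottleFluxEnergy_neg (U δ θ : ℝ) :
    kleinBottleFluxEnergy L U δ (-θ) = kleinBottleFluxEnergy L U δ θ :=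
  minEnergyOn_hubbardKleinBottleFlux_neg L U θ _ _

/-- **The sector energies are `2π`-periodic in the flux** (period one flux quantum `h/e`;
Byers–Yang 1961). [cite: ByersYang1961] -/
theorem kleinBottleFluxEnergy_periodic (U δ : ℝ) :
    Function.Periodic (kleinBottleFluxEnergy L U δ) (2 * Real.pi) := by
  intro θ
  rw [kleinBottleFluxEnergy, hubbardKleinBottleFlux_periodic, kleinBottleFluxEnergy]

end Conj

end Literature.MathematicalPhysics.QuantumLattice

namespace Literature.MathematicalPhysics.QuantumLattice

open Matrix Finset
open scoped ComplexOrder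

/-! ### Conservation laws: `N↑`, `N↓`, `N`, `S^z`, and spin rotations -/

section Conservation

variable (L : ℕ) [NeZero L]

/-- The seam hopping operator conserves `N↑` and `N↓` (a sum of spin-diagonal hoppings). [folklore] -/
theorem preservesSectors_kleinBottleSeamHop : PreservesSectors (kleinBottleSeamHop L) :=
  PreservesSectors.sum fun p _ => PreservesSectors.sum fun q _ => PreservesSectors.sum fun σ _ =>
    (LiebThm1.preservesSectors_hopping q p σ).ite _

/-- Sector preservation passes to the adjoint. [folklore] -/
theorem preservesSectors_kleinBottleSeamHop_conjTranspose :
    PreservesSectors (kleinBottleSeamHop L)ᴴ := by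
  rw [kleinBottleSeamHop_conjTranspose]
  exact PreservesSectors.sum fun p _ => PreservesSectors.sum fun q _ =>
    PreservesSectors.sum fun σ _ => (LiebThm1.preservesSectors_hopping p q σ).ite _

/-- The flux Hamiltonian conserves `N↑` and `N↓`: it is block diagonal in the sectors `(N↑, N↓)`,
exactly like the untwisted Hubbard Hamiltonian. [folklore] -/
theorem preservesSectors_hubbardKleinBottleFlux (U θ : ℝ) :
    PreservesSectors (hubbardKleinBottleFlux L U θ) :=
  (LiebThm1.preservesSectors_hamiltonian (kleinBottleGraph L) 1 U).add
    (((preservesSectors_kleinBottleSeamHop L).smul _).add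
      ((preservesSectors_kleinBottleSeamHop_conjTranspose L).smul _))

/-- `[H(θ), N] = 0`: the flux couples to a conserved charge. [folklore] -/
theorem hubbardKleinBottleFlux_commute_totalNumber (U θ : ℝ) :
    Commute (hubbardKleinBottleFlux L U θ) totalNumber := by
  rw [LiebThm1.totalNumber_eq_diagonal]
  exact (preservesSectors_hubbardKleinBottleFlux L U θ).commute_diagonal fun a b => ((a + b : ℕ) : ℂ)

/-- `[H(θ), S^z] = 0`. [folklore] -/
theorem hubbardKleinBottleFlux_commute_spinZ (U θ : ℝ) :
    Commute (hubbardKleinBottleFlux L U θ) HubbardWave0.spinZ := by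
  rw [LiebThm1.spinZ_eq_diagonal]
  exact (preservesSectors_hubbardKleinBottleFlux L U θ).commute_diagonal
    fun a b => (1 / 2 : ℂ) * ((a : ℂ) - (b : ℂ))

/-- The seam hopping operator commutes with `S⁺` (both spin species hop with the same
amplitude). [folklore] -/
theorem kleinBottleSeamHop_commute_spinPlus : Commute (kleinBottleSeamHop L) spinPlus := by
  unfold kleinBottleSeamHop
  refine Commute.sum_left _ _ _ fun p _ => Commute.sum_left _ _ _ fun q _ => ?_
  by_cases h : kleinBottleSeam L p q
  · simp only [if_pos h]
    exact LiebThm1.sum_hopping_commute_spinPlus q p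
  · simp only [if_neg h, Finset.sum_const_zero]
    exact Commute.zero_left _

/-- The adjoint seam hopping operator commutes with `S⁺`. [folklore] -/
theorem kleinBottleSeamHop_conjTranspose_commute_spinPlus :
    Commute (kleinBottleSeamHop L)ᴴ spinPlus := by
  rw [kleinBottleSeamHop_conjTranspose]
  refine Commute.sum_left _ _ _ fun p _ => Commute.sum_left _ _ _ fun q _ => ?_
  by_cases h : kleinBottleSeam L p q
  · simp only [if_pos h]
    exact LiebThm1.sum_hopping_commute_spinPlus p q
  · simp only [if_neg h, Finset.sum_const_zero]
    exact Commute.zero_left _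

/-- `[H(θ), S⁺] = 0`. [folklore] -/
theorem hubbardKleinBottleFlux_commute_spinPlus (U θ : ℝ) :
    Commute (hubbardKleinBottleFlux L U θ) spinPlus :=
  (LiebThm1.hamiltonian_commute_spinPlus (kleinBottleGraph L) 1 U).add_left
    (((kleinBottleSeamHop_commute_spinPlus L).smul_left _).add_left
      ((kleinBottleSeamHop_conjTranspose_commute_spinPlus L).smul_left _))

/-- `[H(θ), S⁻] = 0` (adjoint of `[H(θ), S⁺] = 0`, `H(θ)` being Hermitian). [folklore] -/
theorem hubbardKleinBottleFlux_commute_spinMinus (U θ : ℝ) :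
    Commute (hubbardKleinBottleFlux L U θ) spinMinus := by
  have h := hubbardKleinBottleFlux_commute_spinPlus L U θ
  rw [Commute, SemiconjBy] at h ⊢
  have h' := congrArg conjTranspose h
  rw [conjTranspose_mul, conjTranspose_mul, (isHermitian_hubbardKleinBottleFlux L U θ).eq] at h'
  exact h'.symm

/-- **Spin-rotation invariance**: `[H(θ), S^α] = 0` for `α = x, y, z` — the Aharonov–Bohm flux
through the glide cycle couples to the charge `U(1)` only. [folklore] -/
theorem hubbardKleinBottleFlux_commute_spinVecF (U θ : ℝ) (α : Fin 3) :
    Commute (hubbardKleinBottleFlux L U θ) (spinVecF α) :=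
  commute_spinVecF_of_commute (hubbardKleinBottleFlux_commute_spinPlus L U θ)
    (hubbardKleinBottleFlux_commute_spinMinus L U θ) (hubbardKleinBottleFlux_commute_spinZ L U θ) α

end Conservation

end Literature.MathematicalPhysics.QuantumLattice
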